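import Summits.QuantumFields.BalabanUV.T4Continuum.Support.NE7FlatCurvedPointwise
import Summits.QuantumFields.BalabanUV.T4Continuum.Support.NE3CurlStability
import Summits.QuantumFields.BalabanUV.T4Continuum.Spine.NE3.SlicePoincareSlicB8Gauge
import HarnessLib

/-!
# NE7GaugedDivGradientNearFlat — supplier stub (S-d′) brick (ROAD-G107 §6 (c″)): ONE LATTICE DERIVATIVE OF THE FLAT DIVERGENCE OF A GAUGED FIELD —
# `flatDiv (Y^{u}) = Ad_{u}(div_W Y) − Σ_μ (Ad_{W^{u}(x,μ)} − 1)Y^{u}(x,μ)` exactly (gauge covariance `NE3.SlicePoincareSlicB8Gauge.covDiv_gaugeAct` +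
# `NE7FlatCurvedPointwise.covDiv_sub_flatDiv`), and at a `δ`-flat gauged background the defect `s₀(x) := Σ_μ (Ad_{W^{u}(x,μ)} − 1)Y^{u}(x,μ)` is
# `≤ 2dδS` with adjacent differences `≤ d(2δG′ + 4δS)` — so in the split `flatDiv Y^{u} = g + s` of the flat C¹ letters the TRANSPORTED DIVERGENCE
# `g = Ad_u(div_W Y)` goes to the logarithmic term (`NE7FlatGradientLetterBlockDiv`, any bounded `g`) and `s = −s₀` carries a small `D′`

Cell `pub-balaban`, rung (B)+1 sub-cell t4, lineage `b2b-balaban-t4-ne7-p1`, generation 107 (CRUX PROVER NE7 #1 = OWNER of BINDER row NE7).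
Memo `t4/b2b-balaban-t4-ne7-p1-g107/ROAD-G107.md` §6; companions `NE7GaugedGradientNearFlat` (c), `NE7GaugedCurlGradientNearFlat` (c′).
WHY.  One derivative up the divergence datum of the bootstrap is SIMPLER than gen 101's `div_datum` (no `loopRad`∕`σ` bookkeeping for the within-block variation of the
transported block constants): the logarithmic letter takes the whole transported divergence `Ad_u(div_W Y)` as an arbitrary bounded `g` (`‖g‖ = ‖div_W Y‖ ≤ sup|c|`), and
only the near-flat defect needs a Lipschitz letter.
WHAT ([folklore]; 0 def, 0 sorry; any dimension, any `n`).  `flatDiv_dirGauge_eq` (the identity), `norm_divDefect_le` (`≤ d·2δS`), **`norm_fdiff_divDefect_le`**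
(`‖s₀(x+e_λ) − s₀(x)‖ ≤ d·(2δG′ + 4δS)`), **`flatDiv_dirGauge_split`** (the split `flatDiv Y^{u} x = Ad_{u x}(div_W Y x) + (−s₀ x)` with both letters).
HONEST FRAMING (page 1): gauge-covariance algebra on OUR objects; nothing of Bałaban's asserted; nothing of NE3∕NE7 discharged; spine count = dagwriter∕referees' call; FIXED FINITE T⁴,
rung (B)+1 — NOT infinite volume, NOT mass gap, NOT BetaPertH, NOT Clay.
-/

set_option autoImplicit false

open scoped BigOperators Matrix.Norms.L2Operator
open NormedSpace Finset

namespace Summit.QuantumFields.BalabanUV.T4Continuum.NE7GaugedDivGradientNearFlat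

open Literature.MathematicalPhysics.QuantumFieldTheory.Balaban1983to89
open B7Prop1Explicit B7Prop2Explicit
open T4AveragingDeficitWall (Ad IsUnitaryCfg)
open T4AveragingDeficitNonAbelian (Ad_sub)
open AveragingDeficitTransport (norm_Ad_of_unitary)
open AveragingDeficitNearIdentity (norm_Ad_sub_le)
open AveragingDeficitLocality (dirGauge)
open NE3CovariantWeitzenbock (covDiv)
open NE3CoercivityScaling (flatDiv)
open NE3CurlStability (norm_Ad_sub_Ad_le)
open NE7FlatCurvedPointwise (covDiv_sub_flatDiv)
open NE3.SlicePoincareSlicB8Gauge (covDiv_gaugeAct)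

noncomputable section

variable {d : ℕ} {n : Type*} [Fintype n] [DecidableEq n]

/-- **THE IDENTITY**: `flatDiv (Y^{u}) x = Ad_{u x}(div_W Y x) − Σ_μ (Ad_{W^{u}(x,μ)} − 1)Y^{u}(x,μ)`. [folklore] -/
theorem flatDiv_dirGauge_eq (u : Site d → (Matrix n n ℂ)ˣ) (W : Site d → Fin d → (Matrix n n ℂ)ˣ) (Y : Site d → Fin d → Matrix n n ℂ) (x : Site d) :
    flatDiv (dirGauge u Y) x = Ad (u x) (covDiv W Y x) - ∑ μ : Fin d, (Ad (gaugeAct u W x μ) (dirGauge u Y x μ) - dirGauge u Y x μ) := by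
  rw [← covDiv_gaugeAct, ← covDiv_sub_flatDiv]; abel

/-- The defect's size: `‖Σ_μ (Ad_{V(x,μ)} − 1)ψ(x,μ)‖ ≤ d·(2δS)` for unitary `V` with `‖V(b) − 1‖ ≤ δ`, `‖ψ‖ ≤ S`. [folklore] -/
theorem norm_divDefect_le [Nonempty n] {V : Site d → Fin d → (Matrix n n ℂ)ˣ} (hV : IsUnitaryCfg V) (ψ : Site d → Fin d → Matrix n n ℂ) {δ S : ℝ}
    (hδ : ∀ (y : Site d) (μ : Fin d), ‖((V y μ : (Matrix n n ℂ)ˣ) : Matrix n n ℂ) - 1‖ ≤ δ) (hS : ∀ y μ, ‖ψ y μ‖ ≤ S) (x : Site d) :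
    ‖∑ μ : Fin d, (Ad (V x μ) (ψ x μ) - ψ x μ)‖ ≤ d * (2 * δ * S) := by
  calc ‖∑ μ : Fin d, (Ad (V x μ) (ψ x μ) - ψ x μ)‖ ≤ ∑ μ : Fin d, ‖Ad (V x μ) (ψ x μ) - ψ x μ‖ := norm_sum_le _ _
    _ ≤ ∑ _μ : Fin d, 2 * δ * S := sum_le_sum fun μ _ => by
        have hδ0 : 0 ≤ δ := (norm_nonneg _).trans (hδ x μ)
        exact (norm_Ad_sub_le (hV x μ) (ψ x μ)).trans (mul_le_mul (mul_le_mul_of_nonneg_left (hδ x μ) (by norm_num)) (hS x μ) (norm_nonneg _) (by positivity))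
    _ = d * (2 * δ * S) := by rw [sum_const, card_univ, Fintype.card_fin, nsmul_eq_mul]

/-- **THE DEFECT IS LIPSCHITZ**: `‖s₀(x+e_λ) − s₀(x)‖ ≤ d·(2δG′ + 4δS)` where `s₀(x) = Σ_μ (Ad_{V(x,μ)} − 1)ψ(x,μ)`, `‖V(b) − 1‖ ≤ δ`, `‖ψ‖ ≤ S`,
`‖ψ(y+e_λ,μ) − ψ(y,μ)‖ ≤ G′`. [folklore] -/
theorem norm_fdiff_divDefect_le [Nonempty n] {V : Site d → Fin d → (Matrix n n ℂ)ˣ} (hV : IsUnitaryCfg V) (ψ : Site d → Fin d → Matrix n n ℂ) {δ S G' : ℝ}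
    (hδ : ∀ (y : Site d) (μ : Fin d), ‖((V y μ : (Matrix n n ℂ)ˣ) : Matrix n n ℂ) - 1‖ ≤ δ) (hS : ∀ y μ, ‖ψ y μ‖ ≤ S)
    (hG : ∀ (y : Site d) (lam μ : Fin d), ‖ψ (y + e lam) μ - ψ y μ‖ ≤ G') (x : Site d) (lam : Fin d) :
    ‖(∑ μ : Fin d, (Ad (V (x + e lam) μ) (ψ (x + e lam) μ) - ψ (x + e lam) μ)) - ∑ μ : Fin d, (Ad (V x μ) (ψ x μ) - ψ x μ)‖
      ≤ d * (2 * δ * G' + 4 * δ * S) := by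
  rw [← sum_sub_distrib]
  have hterm : ∀ μ ∈ (univ : Finset (Fin d)),
      ‖(Ad (V (x + e lam) μ) (ψ (x + e lam) μ) - ψ (x + e lam) μ) - (Ad (V x μ) (ψ x μ) - ψ x μ)‖ ≤ 2 * δ * G' + 4 * δ * S := by
    intro μ _
    have hδ0 : 0 ≤ δ := (norm_nonneg _).trans (hδ x μ)
    set T := V x μ
    set T' := V (x + e lam) μ
    have e1 : (Ad T' (ψ (x + e lam) μ) - ψ (x + e lam) μ) - (Ad T (ψ x μ) - ψ x μ)
        = (Ad T' (ψ (x + e lam) μ - ψ x μ) - (ψ (x + e lam) μ - ψ x μ)) + (Ad T' (ψ x μ) - Ad T (ψ x μ)) := by rw [Ad_sub]; abel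
    rw [e1]
    have h1 := norm_Ad_sub_le (hV (x + e lam) μ) (ψ (x + e lam) μ - ψ x μ)
    have h2 := norm_Ad_sub_Ad_le (hV x μ) (hV (x + e lam) μ) (ψ x μ)
    have h3 : ‖((T' : (Matrix n n ℂ)ˣ) : Matrix n n ℂ) - (T : Matrix n n ℂ)‖ ≤ δ + δ := by
      calc ‖((T' : (Matrix n n ℂ)ˣ) : Matrix n n ℂ) - (T : Matrix n n ℂ)‖ = ‖(((T' : (Matrix n n ℂ)ˣ) : Matrix n n ℂ) - 1) - (((T : (Matrix n n ℂ)ˣ) : Matrix n n ℂ) - 1)‖ := by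
            congr 1; abel
        _ ≤ _ := (norm_sub_le _ _).trans (add_le_add (hδ _ _) (hδ _ _))
    calc _ ≤ ‖Ad T' (ψ (x + e lam) μ - ψ x μ) - (ψ (x + e lam) μ - ψ x μ)‖ + ‖Ad T' (ψ x μ) - Ad T (ψ x μ)‖ := norm_add_le _ _
      _ ≤ 2 * ‖((T' : (Matrix n n ℂ)ˣ) : Matrix n n ℂ) - 1‖ * ‖ψ (x + e lam) μ - ψ x μ‖ + 2 * ‖((T' : (Matrix n n ℂ)ˣ) : Matrix n n ℂ) - (T : Matrix n n ℂ)‖ * ‖ψ x μ‖ :=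
          add_le_add h1 h2
      _ ≤ 2 * δ * G' + 2 * (δ + δ) * S :=
          add_le_add (mul_le_mul (mul_le_mul_of_nonneg_left (hδ _ _) (by norm_num)) (hG x lam μ) (norm_nonneg _) (by positivity))
            (mul_le_mul (mul_le_mul_of_nonneg_left h3 (by norm_num)) (hS x μ) (norm_nonneg _) (by positivity))
      _ = 2 * δ * G' + 4 * δ * S := by ring
  calc _ ≤ ∑ μ : Fin d, ‖(Ad (V (x + e lam) μ) (ψ (x + e lam) μ) - ψ (x + e lam) μ) - (Ad (V x μ) (ψ x μ) - ψ x μ)‖ := norm_sum_le _ _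
    _ ≤ ∑ _μ : Fin d, (2 * δ * G' + 4 * δ * S) := sum_le_sum hterm
    _ = d * (2 * δ * G' + 4 * δ * S) := by rw [sum_const, card_univ, Fintype.card_fin, nsmul_eq_mul]

/-- **THE SPLIT OF THE GAUGED FIELD'S FLAT DIVERGENCE FOR THE FLAT C¹ LETTERS**: `W, u` unitary, `‖W^{u}(b) − 1‖ ≤ δ` on every bond, `‖Y‖ ≤ S`, plain gradient of `Y^{u}` `≤ G′`,
`‖div_W Y‖ ≤ Gc`.  With `g x := Ad_{u x}(div_W Y x)` and `s x := −Σ_μ (Ad_{W^{u}(x,μ)} − 1)Y^{u}(x,μ)`: `flatDiv Y^{u} x = g x + s x`, `‖g x‖ ≤ Gc`, `‖s x‖ ≤ d·2δS`,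
`‖s(x+e_λ) − s x‖ ≤ d(2δG′ + 4δS)`. [folklore] -/
theorem flatDiv_dirGauge_split [Nonempty n] {W : Site d → Fin d → (Matrix n n ℂ)ˣ} (hW : IsUnitaryCfg W) {u : Site d → (Matrix n n ℂ)ˣ}
    (hu : ∀ y, u y ∈ unitaryUnits (Matrix n n ℂ)) (Y : Site d → Fin d → Matrix n n ℂ) {δ S G' Gc : ℝ}
    (hδ : ∀ (y : Site d) (μ : Fin d), ‖((gaugeAct u W y μ : (Matrix n n ℂ)ˣ) : Matrix n n ℂ) - 1‖ ≤ δ) (hS : ∀ y μ, ‖Y y μ‖ ≤ S)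
    (hG' : ∀ (y : Site d) (lam μ : Fin d), ‖dirGauge u Y (y + e lam) μ - dirGauge u Y y μ‖ ≤ G') (hGc : ∀ y, ‖covDiv W Y y‖ ≤ Gc)
    (x : Site d) (lam : Fin d) :
    flatDiv (dirGauge u Y) x = Ad (u x) (covDiv W Y x) + (-(∑ μ : Fin d, (Ad (gaugeAct u W x μ) (dirGauge u Y x μ) - dirGauge u Y x μ))) ∧
    ‖Ad (u x) (covDiv W Y x)‖ ≤ Gc ∧
    ‖-(∑ μ : Fin d, (Ad (gaugeAct u W x μ) (dirGauge u Y x μ) - dirGauge u Y x μ))‖ ≤ d * (2 * δ * S) ∧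
    ‖-(∑ μ : Fin d, (Ad (gaugeAct u W (x + e lam) μ) (dirGauge u Y (x + e lam) μ) - dirGauge u Y (x + e lam) μ))
        - -(∑ μ : Fin d, (Ad (gaugeAct u W x μ) (dirGauge u Y x μ) - dirGauge u Y x μ))‖ ≤ d * (2 * δ * G' + 4 * δ * S) := by
  have hVu : IsUnitaryCfg (gaugeAct u W) := fun y κ =>
    (unitaryUnits _).mul_mem ((unitaryUnits _).mul_mem (hu _) (hW _ _)) ((unitaryUnits _).inv_mem (hu _))
  have hψS : ∀ y μ, ‖dirGauge u Y y μ‖ ≤ S := fun y μ => by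
    rw [show dirGauge u Y y μ = Ad (u (y + e μ)) (Y y μ) from rfl, norm_Ad_of_unitary (hu _)]; exact hS y μ
  refine ⟨by rw [flatDiv_dirGauge_eq, sub_eq_add_neg], by rw [norm_Ad_of_unitary (hu x)]; exact hGc x, ?_, ?_⟩
  · rw [norm_neg]; exact norm_divDefect_le hVu (dirGauge u Y) hδ hψS x
  · rw [neg_sub_neg, norm_sub_rev]; exact norm_fdiff_divDefect_le hVu (dirGauge u Y) hδ hψS hG' x lam

end

end Summit.QuantumFields.BalabanUV.T4Continuum.NE7GaugedDivGradientNearFlat
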